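import Mathlib
import Summits.Ventures.HodgeRepro.BallGenLemmaW
import Summits.Ventures.HodgeRepro.BallGenHolo
import Summits.Ventures.HodgeRepro.ZariskiWedge

/-!
# R5 steps (2)+(4) composed: Lemma W's translates and the rational point (seat p3)

ROUTE-C R5 / ROUTE.md A4 read at one point `z` of the ball: step (2) (Lemma W, typer-2's
`lemmaW_iter`) produces Hecke translates `γ_i ∈ Δ` and a point `z` at which the pulled-back
eigenforms `(γ_i^*F_i)(z)` are linearly independent; step (4) (`ZariskiWedge.lean`) turns a complex
witness into a `T`-rational one inside any `ℂ`-linear families `ω_i` (the `σ_i`-eigenspaces at a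
level deep enough to contain the translates `γ_i^*F_i`).  `lemmaW_rational_point` states both at
once: for `g′ = |ι| ≤ p` continuous, nowhere-identically-zero fields `F_i` and a dense `Δ ≤ U(p,1)`
there are `γ_i ∈ Δ` and `z` with `(γ_i^*F_i)(z)` independent, AND for every finite family of
`ℂ`-linear maps `ω_i : ℂ^m → (𝔹^p → ℂ^p)` with `γ_i^*F_i ∈ range (ω_i)` there is a rational
`v ∈ T^m` with `(ω_i((σ_i(v_j))_j))(z)` independent.  The deepening of the level (the translates
live on `Γ ∩ ⋂ γ_i⁻¹Γγ_i`) is the hypothesis `γ_i^*F_i ∈ range ω_i`; its congruence/finite-index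
content is kernel-checked elsewhere (p5 CongruenceHermitianCover, p3 BallGenLemmaWCover).
Nothing here says anything about the status of the Hodge conjecture for CM abelian varieties,
which is NOT proved.
-/

set_option autoImplicit false

namespace HodgeRepro.Zariski

open HodgeRepro.BallGen

/-- **Lemma W's translates plus the rational point (R5 steps (2)+(4) at one point).**  Dense
`Δ ≤ U(p,1)`; `g′ = |ι| ≤ p` continuous fields `F i : 𝔹^p → ℂ^p`, each non-zero somewhere; distinct
embeddings `σ i : K → ℂ`.  Then there are `γ i ∈ Δ` and a point `z` with `(γ_i^*F_i)(z)` linearly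
independent, and for every finite family of `ℂ`-linear maps `ω i : ℂ^m → (𝔹^p → ℂ^p)` whose ranges
contain the translates `γ_i^*F_i`, some rational `v : m → K` makes `(ω i ((σ i (v j))_j)) z`
linearly independent. -/
theorem lemmaW_rational_point {p : ℕ} {Δ : Subgroup (U p)} (hΔ : Dense (Δ : Set (U p)))
    {ι : Type} [Fintype ι] [DecidableEq ι] (K : Type*) [Field K] [NumberField K]
    (σ : ι → (K →ₐ[ℚ] ℂ)) (hσ : Function.Injective σ) (F : ι → Ball p → Fin p → ℂ)
    (hF : ∀ i, Continuous (F i)) (hF0 : ∀ i, ∃ w, F i w ≠ 0) (hcard : Fintype.card ι ≤ p) :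
    ∃ γ : ι → U p, (∀ i, γ i ∈ Δ) ∧ ∃ z : Ball p,
      LinearIndependent ℂ (fun i => pullback (γ i) (F i) z) ∧
      ∀ (m : Type) [Fintype m] (ω : ι → ((m → ℂ) →ₗ[ℂ] (Ball p → Fin p → ℂ))),
        (∀ i, ∃ w, ω i w = pullback (γ i) (F i)) →
        ∃ v : m → K, LinearIndependent ℂ fun i => ω i (fun j => σ i (v j)) z := by
  set e := Fintype.equivFin ι with he
  obtain ⟨γ', hγ'Δ, z, hz⟩ := lemmaW_iter hΔ (Fintype.card ι) hcard (fun j => F (e.symm j))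
    (fun j => hF _) (fun j => hF0 _)
  have hli : LinearIndependent ℂ fun i => pullback (γ' (e i)) (F i) z := by
    have h := hz.comp e e.injective
    convert h using 1
    funext i
    simp only [Function.comp, Equiv.symm_apply_apply]
  refine ⟨fun i => γ' (e i), fun i => hγ'Δ _, z, hli, ?_⟩
  · intro m _ ω hω
    choose w hw using hω
    have hli' : LinearIndependent ℂ fun i => ((LinearMap.proj z).comp (ω i)) (w i) := by
      convert hli using 1
      funext i
      rw [LinearMap.comp_apply, LinearMap.proj_apply, hw]
    obtain ⟨v, hv⟩ := exists_rat_linearIndependent_of_injective K σ hσ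
      (fun i => (LinearMap.proj z).comp (ω i)) w hli'
    exact ⟨v, hv⟩

open HodgeRepro.BallGen.Holo in
/-- **Lemma W's translates plus the rational point at a GENERIC point (analytic fields).**  Dense
`Δ ≤ U(p,1)`; `g′ = |ι| ≤ p` (`ι` non-empty) `ℂ`-analytic fields `F i` on the ball, each non-zero
somewhere; distinct embeddings `σ i : K → ℂ`.  Then there are `γ i ∈ Δ` and an OPEN DENSE set
`U ⊂ 𝔹^p` such that at every `z ∈ U` the translates `(γ_i^*F_i)(z)` are linearly independent and,
for every finite family of `ℂ`-linear maps `ω i : ℂ^m → (𝔹^p → ℂ^p)` whose ranges contain the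
translates, some rational `v : m → K` makes `(ω i ((σ i (v j))_j)) z` linearly independent. -/
theorem lemmaW_rational_point_holo {p : ℕ} {Δ : Subgroup (U p)} (hΔ : Dense (Δ : Set (U p)))
    {ι : Type} [Fintype ι] [DecidableEq ι] [Nonempty ι] (K : Type*) [Field K] [NumberField K]
    (σ : ι → (K →ₐ[ℚ] ℂ)) (hσ : Function.Injective σ) (F : ι → (Fin p → ℂ) → (Fin p → ℂ))
    (hF : ∀ i, AnalyticOnNhd ℂ (F i) (ballSet p)) (hF0 : ∀ i, ∃ w : Ball p, F i w.1 ≠ 0)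
    (hcard : Fintype.card ι ≤ p) :
    ∃ γ : ι → U p, (∀ i, γ i ∈ Δ) ∧ ∃ U : Set (Ball p), IsOpen U ∧ Dense U ∧ ∀ z ∈ U,
      LinearIndependent ℂ (fun i => pullback (γ i) (fun w : Ball p => F i w.1) z) ∧
      ∀ (m : Type) [Fintype m] (ω : ι → ((m → ℂ) →ₗ[ℂ] (Ball p → Fin p → ℂ))),
        (∀ i, ∃ w, ω i w = pullback (γ i) (fun w : Ball p => F i w.1)) →
        ∃ v : m → K, LinearIndependent ℂ fun i => ω i (fun j => σ i (v j)) z := by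
  classical
  obtain ⟨i₀⟩ := ‹Nonempty ι›
  set e := Fintype.equivFin ι with he
  -- pad the `g′` fields to `p` fields with copies of `F i₀`
  set F' : Fin p → (Fin p → ℂ) → (Fin p → ℂ) := fun j =>
    if h : j.val < Fintype.card ι then F (e.symm ⟨j.val, h⟩) else F i₀ with hF'
  have hF'an : ∀ j, AnalyticOnNhd ℂ (F' j) (ballSet p) := by
    intro j
    simp only [hF']
    split_ifs <;> exact hF _
  have hF'0 : ∀ j, ∃ w : Ball p, F' j w.1 ≠ 0 := by
    intro j
    simp only [hF']
    split_ifs <;> exact hF0 _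
  obtain ⟨γ', hγ'Δ, hopen, hdense⟩ := lemmaW_generic hΔ hF'an hF'0
  set ι' : ι → Fin p := fun i => Fin.castLE hcard (e i) with hι'
  have hι'inj : Function.Injective ι' := (Fin.castLE_injective hcard).comp e.injective
  have hF'i : ∀ i, F' (ι' i) = F i := by
    intro i
    simp only [hF', hι', Fin.val_castLE, Fin.is_lt, dif_pos, Fin.eta, Equiv.symm_apply_apply]
  refine ⟨fun i => γ' (ι' i), fun i => hγ'Δ _, _, hopen, hdense, ?_⟩
  intro z hz
  have hli : LinearIndependent ℂ fun i => pullback (γ' (ι' i)) (fun w : Ball p => F i w.1) z := by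
    have h := (hz : LinearIndependent ℂ fun j =>
      pullback (γ' j) (fun w : Ball p => F' j w.1) z).comp ι' hι'inj
    convert h using 1
    funext i
    simp only [Function.comp, hF'i]
  refine ⟨hli, ?_⟩
  intro m _ ω hω
  choose w hw using hω
  have hli' : LinearIndependent ℂ fun i => ((LinearMap.proj z).comp (ω i)) (w i) := by
    convert hli using 1
    funext i
    rw [LinearMap.comp_apply, LinearMap.proj_apply, hw]
  obtain ⟨v, hv⟩ := exists_rat_linearIndependent_of_injective K σ hσ
    (fun i => (LinearMap.proj z).comp (ω i)) w hli'
  exact ⟨v, hv⟩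

end HodgeRepro.Zariski
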